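import Summits.AtomisticToContinuum.Crystallization.Theorems.HullExactificationCascadeZeroDefectDensityCoordsFccFrame
import HarnessLib

/-!
# Coordinates of a soft fcc shell — II: the eight good points
# (route `HullExactificationCascade`, crux `ZeroDefectDensity`, stmt-AtomisticToContinuum-12086; stub `stub_coordsFcc`)

Support file (lead c4, stub-worker) for the registered stub `stub_coordsFcc`; continuation of
`…CoordsFccFrame`.  In the Gram–Schmidt frame `b₁, b₂, b₃` on `v₁ = p 0 + p 1`, `v₂ = p 0 - p 1`,
`v₃ = p 4 - p 5` (abstracted here through the coordinate formulas `hX`, `hY`, `hZ` and the frame numbers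
`n₁, n₂, n₃ ≈ √2`, `s₂₁ = ⟪v₂, b₁⟫`, `s₃₁ = ⟪v₃, b₁⟫`, `s₃₂ = ⟪v₃, b₂⟫ ≈ 0`), the SCALED coordinates
`√2 ⟪p i, b_k⟫` of the eight GOOD points `i ∈ {0, 1, 4, 5, 8, 9, 10, 11}` — those whose distances to
all four frame points `p 0, p 1, p 4, p 5` are pinned by the hypotheses (self, contact, `√2` or `√3`) —
are within explicit constants `≤ 202/10000` of the integer entries `fccTab i k`:

* `std_X`, `std_Y`, `std_Z` — the three generic coordinate estimates (numerator from the Gram data,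
  denominator `2 ± 141/10000` by `scaled_div_bound`);
* `fcc_pt0`, `fcc_pt1`, `fcc_pt4`, `fcc_pt5`, `fcc_pt8`, `fcc_pt9`, `fcc_pt10`, `fcc_pt11`;
* `parseval_scaled`, `solve_coord`, `abs_scaled_le`, `abs_le_of_scaled` — generic lemmas used for the
  bad points in `…CoordsFccBad`.

The four bad points (antipodes of the frame points) and the assembly of the stub are in
`…CoordsFccBad`, `…CoordsFcc`.  All constants were verified in exact rational arithmetic. [folklore]
-/

noncomputable section

namespace Summit.AtomisticToContinuum.Crystallization.Theorems.ZeroDefectDensityBirth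

open Real RealInnerProductSpace Literature.Geometry.DiscreteGeometry

/-! ### The three standard coordinate estimates -/

/-- A priori bound: `|⟪x, b⟫| ≤ ‖x‖ ≤ M` for a unit vector `b`. [folklore] -/
theorem abs_inner_unit_le {x b : EuclideanSpace ℝ (Fin 3)} {M : ℝ} (hb : ‖b‖ = 1) (hx : ‖x‖ ≤ M) : |⟪x, b⟫| ≤ M :=
  (abs_real_inner_le_norm x b).trans (by rw [hb, mul_one]; exact hx)

/-- First coordinate: `√2 ⟪x, b₁⟫ = √2 ⟪x, v₁⟫/‖v₁‖` is within `(e + |t|δ/2)/(1 - δ/2)` of `t` when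
`⟪x, v₁⟫ = t ± e` (`δ = 141/10000`). [folklore] -/
theorem std_X {p : Fin 12 → EuclideanSpace ℝ (Fin 3)} {b₁ : EuclideanSpace ℝ (Fin 3)} {n₁ : ℝ} (hX : ∀ x : EuclideanSpace ℝ (Fin 3), ⟪x, b₁⟫ = ⟪x, p 0 + p 1⟫ / n₁)
    (hn₁ : |n₁ ^ 2 - 2| ≤ 141 / 10000) (hn₁0 : 0 < n₁) {x : EuclideanSpace ℝ (Fin 3)} {t e : ℝ}
    (h : |⟪x, p 0 + p 1⟫ - t| ≤ e) :
    |Real.sqrt 2 * ⟪x, b₁⟫ - t| ≤ (e + |t| * (141 / 10000 / 2)) / (1 - 141 / 10000 / 2) := by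
  rw [hX, ← mul_div_assoc]
  exact scaled_div_bound h hn₁ hn₁0 (by norm_num)

/-- Second coordinate: `√2 ⟪x, b₂⟫ = √2 (⟪x, v₂⟫ - ⟪v₂, b₁⟫⟪x, b₁⟫)/‖w₂‖` is within
`(e + (3/2000) M + |t|δ/2)/(1 - δ/2)` of `t` when `⟪x, v₂⟫ = t ± e` and `|⟪x, b₁⟫| ≤ M`. [folklore] -/
theorem std_Y {p : Fin 12 → EuclideanSpace ℝ (Fin 3)} {b₁ b₂ : EuclideanSpace ℝ (Fin 3)} {n₂ s₂₁ : ℝ}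
    (hY : ∀ x : EuclideanSpace ℝ (Fin 3), ⟪x, b₂⟫ = (⟪x, p 0 - p 1⟫ - s₂₁ * ⟪x, b₁⟫) / n₂)
    (hn₂ : |n₂ ^ 2 - 2| ≤ 141 / 10000) (hn₂0 : 0 < n₂) (hs₂₁ : |s₂₁| ≤ 3 / 2000) {x : EuclideanSpace ℝ (Fin 3)}
    {t e M : ℝ} (h : |⟪x, p 0 - p 1⟫ - t| ≤ e) (hM : |⟪x, b₁⟫| ≤ M) :
    |Real.sqrt 2 * ⟪x, b₂⟫ - t| ≤
      (e + 3 / 2000 * M + |t| * (141 / 10000 / 2)) / (1 - 141 / 10000 / 2) := by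
  rw [hY, ← mul_div_assoc]
  refine scaled_div_bound ?_ hn₂ hn₂0 (by norm_num)
  have hm := mul_bounds_of_abs_le hs₂₁ hM
  have h' := abs_le.1 h
  rw [abs_le]; constructor <;> linarith [h'.1, h'.2, hm.1, hm.2]

/-- Third coordinate: `√2 ⟪x, b₃⟫ = √2 (⟪x, v₃⟫ - ⟪v₃, b₁⟫⟪x, b₁⟫ - ⟪v₃, b₂⟫⟪x, b₂⟫)/‖w₃‖` is within
`(e + (3/1000)(M₁ + M₂) + |t|δ/2)/(1 - δ/2)` of `t` when `⟪x, v₃⟫ = t ± e`, `|⟪x, b₁⟫| ≤ M₁`,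
`|⟪x, b₂⟫| ≤ M₂`. [folklore] -/
theorem std_Z {p : Fin 12 → EuclideanSpace ℝ (Fin 3)} {b₁ b₂ b₃ : EuclideanSpace ℝ (Fin 3)} {n₃ s₃₁ s₃₂ : ℝ}
    (hZ : ∀ x : EuclideanSpace ℝ (Fin 3), ⟪x, b₃⟫ = (⟪x, p 4 - p 5⟫ - s₃₁ * ⟪x, b₁⟫ - s₃₂ * ⟪x, b₂⟫) / n₃)
    (hn₃ : |n₃ ^ 2 - 2| ≤ 141 / 10000) (hn₃0 : 0 < n₃) (hs₃₁ : |s₃₁| ≤ 3 / 1000)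
    (hs₃₂ : |s₃₂| ≤ 3 / 1000) {x : EuclideanSpace ℝ (Fin 3)} {t e M₁ M₂ : ℝ} (h : |⟪x, p 4 - p 5⟫ - t| ≤ e)
    (hM₁ : |⟪x, b₁⟫| ≤ M₁) (hM₂ : |⟪x, b₂⟫| ≤ M₂) :
    |Real.sqrt 2 * ⟪x, b₃⟫ - t| ≤
      (e + 3 / 1000 * M₁ + 3 / 1000 * M₂ + |t| * (141 / 10000 / 2)) / (1 - 141 / 10000 / 2) := by
  rw [hZ, ← mul_div_assoc]
  refine scaled_div_bound ?_ hn₃ hn₃0 (by norm_num)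
  have hm := mul_bounds_of_abs_le hs₃₁ hM₁
  have hm' := mul_bounds_of_abs_le hs₃₂ hM₂
  have h' := abs_le.1 h
  rw [abs_le]; constructor <;> linarith [h'.1, h'.2, hm.1, hm.2, hm'.1, hm'.2]

/-! ### The eight good points -/

/-- Coordinates of the good point `p 0` (`fccTab 0 = (1,1,0)`; types to `p 0, p 1, p 4, p 5`:
itself, `√2`, contact, contact). [folklore] -/
theorem fcc_pt0 {p : Fin 12 → EuclideanSpace ℝ (Fin 3)} {b₁ b₂ b₃ : EuclideanSpace ℝ (Fin 3)} {n₁ n₂ n₃ s₂₁ s₃₁ s₃₂ : ℝ}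
    (hX : ∀ x : EuclideanSpace ℝ (Fin 3), ⟪x, b₁⟫ = ⟪x, p 0 + p 1⟫ / n₁)
    (hY : ∀ x : EuclideanSpace ℝ (Fin 3), ⟪x, b₂⟫ = (⟪x, p 0 - p 1⟫ - s₂₁ * ⟪x, b₁⟫) / n₂)
    (hZ : ∀ x : EuclideanSpace ℝ (Fin 3), ⟪x, b₃⟫ = (⟪x, p 4 - p 5⟫ - s₃₁ * ⟪x, b₁⟫ - s₃₂ * ⟪x, b₂⟫) / n₃)
    (hn₁ : |n₁ ^ 2 - 2| ≤ 141 / 10000) (hn₁0 : 0 < n₁) (hn₂ : |n₂ ^ 2 - 2| ≤ 141 / 10000)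
    (hn₂0 : 0 < n₂) (hn₃ : |n₃ ^ 2 - 2| ≤ 141 / 10000) (hn₃0 : 0 < n₃) (hs₂₁ : |s₂₁| ≤ 3 / 2000)
    (hs₃₁ : |s₃₁| ≤ 3 / 1000) (hs₃₂ : |s₃₂| ≤ 3 / 1000) (hub₁ : ‖b₁‖ = 1) (hub₂ : ‖b₂‖ = 1)
    (hnm : ∀ i, ‖p i‖ ≤ 1 + 1 / 4000) (hG0 : ∀ i, |⟪p i, p i⟫ - 1| ≤ 1 / 1000)
    (hG1 : ∀ i j, fccAdj i j → |⟪p i, p j⟫ - 1 / 2| ≤ 1 / 1000)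
    (hG2 : ∀ i j, sqNormInt (fccTab i - fccTab j) = 4 → |⟪p i, p j⟫| ≤ 3 / 500) :
    |Real.sqrt 2 * ⟪p 0, b₁⟫ - fccTab 0 0| ≤ 71 / 5000 ∧ |Real.sqrt 2 * ⟪p 0, b₂⟫ - fccTab 0 1| ≤ 157 / 10000 ∧
      |Real.sqrt 2 * ⟪p 0, b₃⟫ - fccTab 0 2| ≤ 81 / 10000 := by
  have e0 : ((fccTab 0 0 : ℤ) : ℝ) = 1 := by simp [fccTab]
  have e1 : ((fccTab 0 1 : ℤ) : ℝ) = 1 := by simp [fccTab]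
  have e2 : ((fccTab 0 2 : ℤ) : ℝ) = 0 := by simp [fccTab]
  rw [e0, e1, e2]
  have ga := abs_le.1 (hG0 0); have gb := abs_le.1 (hG2 0 1 (by decide))
  have gc := abs_le.1 (hG1 0 4 (by decide)); have gd := abs_le.1 (hG1 0 5 (by decide))
  have a1 : |⟪p 0, b₁⟫| ≤ 1 + 1 / 4000 := abs_inner_unit_le hub₁ (hnm 0)
  have a2 : |⟪p 0, b₂⟫| ≤ 1 + 1 / 4000 := abs_inner_unit_le hub₂ (hnm 0)
  have cX : |⟪p 0, p 0 + p 1⟫ - 1| ≤ 7 / 1000 := by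
    rw [inner_add_right, abs_le]; constructor <;> linarith [ga.1, ga.2, gb.1, gb.2]
  have cY : |⟪p 0, p 0 - p 1⟫ - 1| ≤ 7 / 1000 := by
    rw [inner_sub_right, abs_le]; constructor <;> linarith [ga.1, ga.2, gb.1, gb.2]
  have cZ : |⟪p 0, p 4 - p 5⟫ - 0| ≤ 1 / 500 := by
    rw [inner_sub_right, abs_le]; constructor <;> linarith [gc.1, gc.2, gd.1, gd.2]
  exact ⟨(std_X hX hn₁ hn₁0 cX).trans (by norm_num), (std_Y hY hn₂ hn₂0 hs₂₁ cY a1).trans (by norm_num),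
    (std_Z hZ hn₃ hn₃0 hs₃₁ hs₃₂ cZ a1 a2).trans (by norm_num)⟩

/-- Coordinates of the good point `p 1` (`fccTab 1 = (1,-1,0)`; types to `p 0, p 1, p 4, p 5`: `√2`,
itself, contact, contact). [folklore] -/
theorem fcc_pt1 {p : Fin 12 → EuclideanSpace ℝ (Fin 3)} {b₁ b₂ b₃ : EuclideanSpace ℝ (Fin 3)} {n₁ n₂ n₃ s₂₁ s₃₁ s₃₂ : ℝ}
    (hX : ∀ x : EuclideanSpace ℝ (Fin 3), ⟪x, b₁⟫ = ⟪x, p 0 + p 1⟫ / n₁)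
    (hY : ∀ x : EuclideanSpace ℝ (Fin 3), ⟪x, b₂⟫ = (⟪x, p 0 - p 1⟫ - s₂₁ * ⟪x, b₁⟫) / n₂)
    (hZ : ∀ x : EuclideanSpace ℝ (Fin 3), ⟪x, b₃⟫ = (⟪x, p 4 - p 5⟫ - s₃₁ * ⟪x, b₁⟫ - s₃₂ * ⟪x, b₂⟫) / n₃)
    (hn₁ : |n₁ ^ 2 - 2| ≤ 141 / 10000) (hn₁0 : 0 < n₁) (hn₂ : |n₂ ^ 2 - 2| ≤ 141 / 10000)
    (hn₂0 : 0 < n₂) (hn₃ : |n₃ ^ 2 - 2| ≤ 141 / 10000) (hn₃0 : 0 < n₃) (hs₂₁ : |s₂₁| ≤ 3 / 2000)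
    (hs₃₁ : |s₃₁| ≤ 3 / 1000) (hs₃₂ : |s₃₂| ≤ 3 / 1000) (hub₁ : ‖b₁‖ = 1) (hub₂ : ‖b₂‖ = 1)
    (hnm : ∀ i, ‖p i‖ ≤ 1 + 1 / 4000) (hG0 : ∀ i, |⟪p i, p i⟫ - 1| ≤ 1 / 1000)
    (hG1 : ∀ i j, fccAdj i j → |⟪p i, p j⟫ - 1 / 2| ≤ 1 / 1000)
    (hG2 : ∀ i j, sqNormInt (fccTab i - fccTab j) = 4 → |⟪p i, p j⟫| ≤ 3 / 500) :
    |Real.sqrt 2 * ⟪p 1, b₁⟫ - fccTab 1 0| ≤ 71 / 5000 ∧ |Real.sqrt 2 * ⟪p 1, b₂⟫ - fccTab 1 1| ≤ 157 / 10000 ∧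
      |Real.sqrt 2 * ⟪p 1, b₃⟫ - fccTab 1 2| ≤ 81 / 10000 := by
  have e0 : ((fccTab 1 0 : ℤ) : ℝ) = 1 := by simp [fccTab]
  have e1 : ((fccTab 1 1 : ℤ) : ℝ) = -1 := by simp [fccTab]
  have e2 : ((fccTab 1 2 : ℤ) : ℝ) = 0 := by simp [fccTab]
  rw [e0, e1, e2]
  have ga := abs_le.1 (hG2 1 0 (by decide)); have gb := abs_le.1 (hG0 1)
  have gc := abs_le.1 (hG1 1 4 (by decide)); have gd := abs_le.1 (hG1 1 5 (by decide))
  have a1 : |⟪p 1, b₁⟫| ≤ 1 + 1 / 4000 := abs_inner_unit_le hub₁ (hnm 1)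
  have a2 : |⟪p 1, b₂⟫| ≤ 1 + 1 / 4000 := abs_inner_unit_le hub₂ (hnm 1)
  have cX : |⟪p 1, p 0 + p 1⟫ - 1| ≤ 7 / 1000 := by
    rw [inner_add_right, abs_le]; constructor <;> linarith [ga.1, ga.2, gb.1, gb.2]
  have cY : |⟪p 1, p 0 - p 1⟫ - -1| ≤ 7 / 1000 := by
    rw [inner_sub_right, abs_le]; constructor <;> linarith [ga.1, ga.2, gb.1, gb.2]
  have cZ : |⟪p 1, p 4 - p 5⟫ - 0| ≤ 1 / 500 := by
    rw [inner_sub_right, abs_le]; constructor <;> linarith [gc.1, gc.2, gd.1, gd.2]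
  exact ⟨(std_X hX hn₁ hn₁0 cX).trans (by norm_num), (std_Y hY hn₂ hn₂0 hs₂₁ cY a1).trans (by norm_num),
    (std_Z hZ hn₃ hn₃0 hs₃₁ hs₃₂ cZ a1 a2).trans (by norm_num)⟩

/-- Coordinates of the good point `p 4` (`fccTab 4 = (1,0,1)`; types to `p 0, p 1, p 4, p 5`:
contact, contact, itself, `√2`). [folklore] -/
theorem fcc_pt4 {p : Fin 12 → EuclideanSpace ℝ (Fin 3)} {b₁ b₂ b₃ : EuclideanSpace ℝ (Fin 3)} {n₁ n₂ n₃ s₂₁ s₃₁ s₃₂ : ℝ}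
    (hX : ∀ x : EuclideanSpace ℝ (Fin 3), ⟪x, b₁⟫ = ⟪x, p 0 + p 1⟫ / n₁)
    (hY : ∀ x : EuclideanSpace ℝ (Fin 3), ⟪x, b₂⟫ = (⟪x, p 0 - p 1⟫ - s₂₁ * ⟪x, b₁⟫) / n₂)
    (hZ : ∀ x : EuclideanSpace ℝ (Fin 3), ⟪x, b₃⟫ = (⟪x, p 4 - p 5⟫ - s₃₁ * ⟪x, b₁⟫ - s₃₂ * ⟪x, b₂⟫) / n₃)
    (hn₁ : |n₁ ^ 2 - 2| ≤ 141 / 10000) (hn₁0 : 0 < n₁) (hn₂ : |n₂ ^ 2 - 2| ≤ 141 / 10000)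
    (hn₂0 : 0 < n₂) (hn₃ : |n₃ ^ 2 - 2| ≤ 141 / 10000) (hn₃0 : 0 < n₃) (hs₂₁ : |s₂₁| ≤ 3 / 2000)
    (hs₃₁ : |s₃₁| ≤ 3 / 1000) (hs₃₂ : |s₃₂| ≤ 3 / 1000) (hub₁ : ‖b₁‖ = 1) (hub₂ : ‖b₂‖ = 1)
    (hnm : ∀ i, ‖p i‖ ≤ 1 + 1 / 4000) (hG0 : ∀ i, |⟪p i, p i⟫ - 1| ≤ 1 / 1000)
    (hG1 : ∀ i j, fccAdj i j → |⟪p i, p j⟫ - 1 / 2| ≤ 1 / 1000)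
    (hG2 : ∀ i j, sqNormInt (fccTab i - fccTab j) = 4 → |⟪p i, p j⟫| ≤ 3 / 500) :
    |Real.sqrt 2 * ⟪p 4, b₁⟫ - fccTab 4 0| ≤ 23 / 2500 ∧ |Real.sqrt 2 * ⟪p 4, b₂⟫ - fccTab 4 1| ≤ 9 / 2500 ∧
      |Real.sqrt 2 * ⟪p 4, b₃⟫ - fccTab 4 2| ≤ 101 / 5000 := by
  have e0 : ((fccTab 4 0 : ℤ) : ℝ) = 1 := by simp [fccTab]
  have e1 : ((fccTab 4 1 : ℤ) : ℝ) = 0 := by simp [fccTab]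
  have e2 : ((fccTab 4 2 : ℤ) : ℝ) = 1 := by simp [fccTab]
  rw [e0, e1, e2]
  have ga := abs_le.1 (hG1 4 0 (by decide)); have gb := abs_le.1 (hG1 4 1 (by decide))
  have gc := abs_le.1 (hG0 4); have gd := abs_le.1 (hG2 4 5 (by decide))
  have a1 : |⟪p 4, b₁⟫| ≤ 1 + 1 / 4000 := abs_inner_unit_le hub₁ (hnm 4)
  have a2 : |⟪p 4, b₂⟫| ≤ 1 + 1 / 4000 := abs_inner_unit_le hub₂ (hnm 4)
  have cX : |⟪p 4, p 0 + p 1⟫ - 1| ≤ 1 / 500 := by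
    rw [inner_add_right, abs_le]; constructor <;> linarith [ga.1, ga.2, gb.1, gb.2]
  have cY : |⟪p 4, p 0 - p 1⟫ - 0| ≤ 1 / 500 := by
    rw [inner_sub_right, abs_le]; constructor <;> linarith [ga.1, ga.2, gb.1, gb.2]
  have cZ : |⟪p 4, p 4 - p 5⟫ - 1| ≤ 7 / 1000 := by
    rw [inner_sub_right, abs_le]; constructor <;> linarith [gc.1, gc.2, gd.1, gd.2]
  exact ⟨(std_X hX hn₁ hn₁0 cX).trans (by norm_num), (std_Y hY hn₂ hn₂0 hs₂₁ cY a1).trans (by norm_num),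
    (std_Z hZ hn₃ hn₃0 hs₃₁ hs₃₂ cZ a1 a2).trans (by norm_num)⟩

/-- Coordinates of the good point `p 5` (`fccTab 5 = (1,0,-1)`; types to `p 0, p 1, p 4, p 5`:
contact, contact, `√2`, itself). [folklore] -/
theorem fcc_pt5 {p : Fin 12 → EuclideanSpace ℝ (Fin 3)} {b₁ b₂ b₃ : EuclideanSpace ℝ (Fin 3)} {n₁ n₂ n₃ s₂₁ s₃₁ s₃₂ : ℝ}
    (hX : ∀ x : EuclideanSpace ℝ (Fin 3), ⟪x, b₁⟫ = ⟪x, p 0 + p 1⟫ / n₁)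
    (hY : ∀ x : EuclideanSpace ℝ (Fin 3), ⟪x, b₂⟫ = (⟪x, p 0 - p 1⟫ - s₂₁ * ⟪x, b₁⟫) / n₂)
    (hZ : ∀ x : EuclideanSpace ℝ (Fin 3), ⟪x, b₃⟫ = (⟪x, p 4 - p 5⟫ - s₃₁ * ⟪x, b₁⟫ - s₃₂ * ⟪x, b₂⟫) / n₃)
    (hn₁ : |n₁ ^ 2 - 2| ≤ 141 / 10000) (hn₁0 : 0 < n₁) (hn₂ : |n₂ ^ 2 - 2| ≤ 141 / 10000)
    (hn₂0 : 0 < n₂) (hn₃ : |n₃ ^ 2 - 2| ≤ 141 / 10000) (hn₃0 : 0 < n₃) (hs₂₁ : |s₂₁| ≤ 3 / 2000)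
    (hs₃₁ : |s₃₁| ≤ 3 / 1000) (hs₃₂ : |s₃₂| ≤ 3 / 1000) (hub₁ : ‖b₁‖ = 1) (hub₂ : ‖b₂‖ = 1)
    (hnm : ∀ i, ‖p i‖ ≤ 1 + 1 / 4000) (hG0 : ∀ i, |⟪p i, p i⟫ - 1| ≤ 1 / 1000)
    (hG1 : ∀ i j, fccAdj i j → |⟪p i, p j⟫ - 1 / 2| ≤ 1 / 1000)
    (hG2 : ∀ i j, sqNormInt (fccTab i - fccTab j) = 4 → |⟪p i, p j⟫| ≤ 3 / 500) :
    |Real.sqrt 2 * ⟪p 5, b₁⟫ - fccTab 5 0| ≤ 23 / 2500 ∧ |Real.sqrt 2 * ⟪p 5, b₂⟫ - fccTab 5 1| ≤ 9 / 2500 ∧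
      |Real.sqrt 2 * ⟪p 5, b₃⟫ - fccTab 5 2| ≤ 101 / 5000 := by
  have e0 : ((fccTab 5 0 : ℤ) : ℝ) = 1 := by simp [fccTab]
  have e1 : ((fccTab 5 1 : ℤ) : ℝ) = 0 := by simp [fccTab]
  have e2 : ((fccTab 5 2 : ℤ) : ℝ) = -1 := by simp [fccTab]
  rw [e0, e1, e2]
  have ga := abs_le.1 (hG1 5 0 (by decide)); have gb := abs_le.1 (hG1 5 1 (by decide))
  have gc := abs_le.1 (hG2 5 4 (by decide)); have gd := abs_le.1 (hG0 5)
  have a1 : |⟪p 5, b₁⟫| ≤ 1 + 1 / 4000 := abs_inner_unit_le hub₁ (hnm 5)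
  have a2 : |⟪p 5, b₂⟫| ≤ 1 + 1 / 4000 := abs_inner_unit_le hub₂ (hnm 5)
  have cX : |⟪p 5, p 0 + p 1⟫ - 1| ≤ 1 / 500 := by
    rw [inner_add_right, abs_le]; constructor <;> linarith [ga.1, ga.2, gb.1, gb.2]
  have cY : |⟪p 5, p 0 - p 1⟫ - 0| ≤ 1 / 500 := by
    rw [inner_sub_right, abs_le]; constructor <;> linarith [ga.1, ga.2, gb.1, gb.2]
  have cZ : |⟪p 5, p 4 - p 5⟫ - -1| ≤ 7 / 1000 := by
    rw [inner_sub_right, abs_le]; constructor <;> linarith [gc.1, gc.2, gd.1, gd.2]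
  exact ⟨(std_X hX hn₁ hn₁0 cX).trans (by norm_num), (std_Y hY hn₂ hn₂0 hs₂₁ cY a1).trans (by norm_num),
    (std_Z hZ hn₃ hn₃0 hs₃₁ hs₃₂ cZ a1 a2).trans (by norm_num)⟩

/-- Coordinates of the good point `p 8` (`fccTab 8 = (0,1,1)`; types to `p 0, p 1, p 4, p 5`:
contact, `√3`, contact, `√3`). [folklore] -/
theorem fcc_pt8 {p : Fin 12 → EuclideanSpace ℝ (Fin 3)} {b₁ b₂ b₃ : EuclideanSpace ℝ (Fin 3)} {n₁ n₂ n₃ s₂₁ s₃₁ s₃₂ : ℝ}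
    (hX : ∀ x : EuclideanSpace ℝ (Fin 3), ⟪x, b₁⟫ = ⟪x, p 0 + p 1⟫ / n₁)
    (hY : ∀ x : EuclideanSpace ℝ (Fin 3), ⟪x, b₂⟫ = (⟪x, p 0 - p 1⟫ - s₂₁ * ⟪x, b₁⟫) / n₂)
    (hZ : ∀ x : EuclideanSpace ℝ (Fin 3), ⟪x, b₃⟫ = (⟪x, p 4 - p 5⟫ - s₃₁ * ⟪x, b₁⟫ - s₃₂ * ⟪x, b₂⟫) / n₃)
    (hn₁ : |n₁ ^ 2 - 2| ≤ 141 / 10000) (hn₁0 : 0 < n₁) (hn₂ : |n₂ ^ 2 - 2| ≤ 141 / 10000)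
    (hn₂0 : 0 < n₂) (hn₃ : |n₃ ^ 2 - 2| ≤ 141 / 10000) (hn₃0 : 0 < n₃) (hs₂₁ : |s₂₁| ≤ 3 / 2000)
    (hs₃₁ : |s₃₁| ≤ 3 / 1000) (hs₃₂ : |s₃₂| ≤ 3 / 1000) (hub₁ : ‖b₁‖ = 1) (hub₂ : ‖b₂‖ = 1)
    (hnm : ∀ i, ‖p i‖ ≤ 1 + 1 / 4000) (hG1 : ∀ i j, fccAdj i j → |⟪p i, p j⟫ - 1 / 2| ≤ 1 / 1000)
    (hG3 : ∀ i j, sqNormInt (fccTab i - fccTab j) = 6 → |⟪p i, p j⟫ + 1 / 2| ≤ 3 / 500) :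
    |Real.sqrt 2 * ⟪p 8, b₁⟫ - fccTab 8 0| ≤ 71 / 10000 ∧ |Real.sqrt 2 * ⟪p 8, b₂⟫ - fccTab 8 1| ≤ 157 / 10000 ∧
      |Real.sqrt 2 * ⟪p 8, b₃⟫ - fccTab 8 2| ≤ 101 / 5000 := by
  have e0 : ((fccTab 8 0 : ℤ) : ℝ) = 0 := by simp [fccTab]
  have e1 : ((fccTab 8 1 : ℤ) : ℝ) = 1 := by simp [fccTab]
  have e2 : ((fccTab 8 2 : ℤ) : ℝ) = 1 := by simp [fccTab]
  rw [e0, e1, e2]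
  have ga := abs_le.1 (hG1 8 0 (by decide)); have gb := abs_le.1 (hG3 8 1 (by decide))
  have gc := abs_le.1 (hG1 8 4 (by decide)); have gd := abs_le.1 (hG3 8 5 (by decide))
  have a1 : |⟪p 8, b₁⟫| ≤ 1 + 1 / 4000 := abs_inner_unit_le hub₁ (hnm 8)
  have a2 : |⟪p 8, b₂⟫| ≤ 1 + 1 / 4000 := abs_inner_unit_le hub₂ (hnm 8)
  have cX : |⟪p 8, p 0 + p 1⟫ - 0| ≤ 7 / 1000 := by
    rw [inner_add_right, abs_le]; constructor <;> linarith [ga.1, ga.2, gb.1, gb.2]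
  have cY : |⟪p 8, p 0 - p 1⟫ - 1| ≤ 7 / 1000 := by
    rw [inner_sub_right, abs_le]; constructor <;> linarith [ga.1, ga.2, gb.1, gb.2]
  have cZ : |⟪p 8, p 4 - p 5⟫ - 1| ≤ 7 / 1000 := by
    rw [inner_sub_right, abs_le]; constructor <;> linarith [gc.1, gc.2, gd.1, gd.2]
  exact ⟨(std_X hX hn₁ hn₁0 cX).trans (by norm_num), (std_Y hY hn₂ hn₂0 hs₂₁ cY a1).trans (by norm_num),
    (std_Z hZ hn₃ hn₃0 hs₃₁ hs₃₂ cZ a1 a2).trans (by norm_num)⟩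

/-- Coordinates of the good point `p 9` (`fccTab 9 = (0,1,-1)`; types to `p 0, p 1, p 4, p 5`:
contact, `√3`, `√3`, contact). [folklore] -/
theorem fcc_pt9 {p : Fin 12 → EuclideanSpace ℝ (Fin 3)} {b₁ b₂ b₃ : EuclideanSpace ℝ (Fin 3)} {n₁ n₂ n₃ s₂₁ s₃₁ s₃₂ : ℝ}
    (hX : ∀ x : EuclideanSpace ℝ (Fin 3), ⟪x, b₁⟫ = ⟪x, p 0 + p 1⟫ / n₁)
    (hY : ∀ x : EuclideanSpace ℝ (Fin 3), ⟪x, b₂⟫ = (⟪x, p 0 - p 1⟫ - s₂₁ * ⟪x, b₁⟫) / n₂)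
    (hZ : ∀ x : EuclideanSpace ℝ (Fin 3), ⟪x, b₃⟫ = (⟪x, p 4 - p 5⟫ - s₃₁ * ⟪x, b₁⟫ - s₃₂ * ⟪x, b₂⟫) / n₃)
    (hn₁ : |n₁ ^ 2 - 2| ≤ 141 / 10000) (hn₁0 : 0 < n₁) (hn₂ : |n₂ ^ 2 - 2| ≤ 141 / 10000)
    (hn₂0 : 0 < n₂) (hn₃ : |n₃ ^ 2 - 2| ≤ 141 / 10000) (hn₃0 : 0 < n₃) (hs₂₁ : |s₂₁| ≤ 3 / 2000)
    (hs₃₁ : |s₃₁| ≤ 3 / 1000) (hs₃₂ : |s₃₂| ≤ 3 / 1000) (hub₁ : ‖b₁‖ = 1) (hub₂ : ‖b₂‖ = 1)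
    (hnm : ∀ i, ‖p i‖ ≤ 1 + 1 / 4000) (hG1 : ∀ i j, fccAdj i j → |⟪p i, p j⟫ - 1 / 2| ≤ 1 / 1000)
    (hG3 : ∀ i j, sqNormInt (fccTab i - fccTab j) = 6 → |⟪p i, p j⟫ + 1 / 2| ≤ 3 / 500) :
    |Real.sqrt 2 * ⟪p 9, b₁⟫ - fccTab 9 0| ≤ 71 / 10000 ∧ |Real.sqrt 2 * ⟪p 9, b₂⟫ - fccTab 9 1| ≤ 157 / 10000 ∧
      |Real.sqrt 2 * ⟪p 9, b₃⟫ - fccTab 9 2| ≤ 101 / 5000 := by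
  have e0 : ((fccTab 9 0 : ℤ) : ℝ) = 0 := by simp [fccTab]
  have e1 : ((fccTab 9 1 : ℤ) : ℝ) = 1 := by simp [fccTab]
  have e2 : ((fccTab 9 2 : ℤ) : ℝ) = -1 := by simp [fccTab]
  rw [e0, e1, e2]
  have ga := abs_le.1 (hG1 9 0 (by decide)); have gb := abs_le.1 (hG3 9 1 (by decide))
  have gc := abs_le.1 (hG3 9 4 (by decide)); have gd := abs_le.1 (hG1 9 5 (by decide))
  have a1 : |⟪p 9, b₁⟫| ≤ 1 + 1 / 4000 := abs_inner_unit_le hub₁ (hnm 9)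
  have a2 : |⟪p 9, b₂⟫| ≤ 1 + 1 / 4000 := abs_inner_unit_le hub₂ (hnm 9)
  have cX : |⟪p 9, p 0 + p 1⟫ - 0| ≤ 7 / 1000 := by
    rw [inner_add_right, abs_le]; constructor <;> linarith [ga.1, ga.2, gb.1, gb.2]
  have cY : |⟪p 9, p 0 - p 1⟫ - 1| ≤ 7 / 1000 := by
    rw [inner_sub_right, abs_le]; constructor <;> linarith [ga.1, ga.2, gb.1, gb.2]
  have cZ : |⟪p 9, p 4 - p 5⟫ - -1| ≤ 7 / 1000 := by
    rw [inner_sub_right, abs_le]; constructor <;> linarith [gc.1, gc.2, gd.1, gd.2]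
  exact ⟨(std_X hX hn₁ hn₁0 cX).trans (by norm_num), (std_Y hY hn₂ hn₂0 hs₂₁ cY a1).trans (by norm_num),
    (std_Z hZ hn₃ hn₃0 hs₃₁ hs₃₂ cZ a1 a2).trans (by norm_num)⟩

/-- Coordinates of the good point `p 10` (`fccTab 10 = (0,-1,1)`; types to `p 0, p 1, p 4, p 5`:
`√3`, contact, contact, `√3`). [folklore] -/
theorem fcc_pt10 {p : Fin 12 → EuclideanSpace ℝ (Fin 3)} {b₁ b₂ b₃ : EuclideanSpace ℝ (Fin 3)} {n₁ n₂ n₃ s₂₁ s₃₁ s₃₂ : ℝ}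
    (hX : ∀ x : EuclideanSpace ℝ (Fin 3), ⟪x, b₁⟫ = ⟪x, p 0 + p 1⟫ / n₁)
    (hY : ∀ x : EuclideanSpace ℝ (Fin 3), ⟪x, b₂⟫ = (⟪x, p 0 - p 1⟫ - s₂₁ * ⟪x, b₁⟫) / n₂)
    (hZ : ∀ x : EuclideanSpace ℝ (Fin 3), ⟪x, b₃⟫ = (⟪x, p 4 - p 5⟫ - s₃₁ * ⟪x, b₁⟫ - s₃₂ * ⟪x, b₂⟫) / n₃)
    (hn₁ : |n₁ ^ 2 - 2| ≤ 141 / 10000) (hn₁0 : 0 < n₁) (hn₂ : |n₂ ^ 2 - 2| ≤ 141 / 10000)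
    (hn₂0 : 0 < n₂) (hn₃ : |n₃ ^ 2 - 2| ≤ 141 / 10000) (hn₃0 : 0 < n₃) (hs₂₁ : |s₂₁| ≤ 3 / 2000)
    (hs₃₁ : |s₃₁| ≤ 3 / 1000) (hs₃₂ : |s₃₂| ≤ 3 / 1000) (hub₁ : ‖b₁‖ = 1) (hub₂ : ‖b₂‖ = 1)
    (hnm : ∀ i, ‖p i‖ ≤ 1 + 1 / 4000) (hG1 : ∀ i j, fccAdj i j → |⟪p i, p j⟫ - 1 / 2| ≤ 1 / 1000)
    (hG3 : ∀ i j, sqNormInt (fccTab i - fccTab j) = 6 → |⟪p i, p j⟫ + 1 / 2| ≤ 3 / 500) :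
    |Real.sqrt 2 * ⟪p 10, b₁⟫ - fccTab 10 0| ≤ 71 / 10000 ∧ |Real.sqrt 2 * ⟪p 10, b₂⟫ - fccTab 10 1| ≤ 157 / 10000 ∧
      |Real.sqrt 2 * ⟪p 10, b₃⟫ - fccTab 10 2| ≤ 101 / 5000 := by
  have e0 : ((fccTab 10 0 : ℤ) : ℝ) = 0 := by simp [fccTab]
  have e1 : ((fccTab 10 1 : ℤ) : ℝ) = -1 := by simp [fccTab]
  have e2 : ((fccTab 10 2 : ℤ) : ℝ) = 1 := by simp [fccTab]
  rw [e0, e1, e2]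
  have ga := abs_le.1 (hG3 10 0 (by decide)); have gb := abs_le.1 (hG1 10 1 (by decide))
  have gc := abs_le.1 (hG1 10 4 (by decide)); have gd := abs_le.1 (hG3 10 5 (by decide))
  have a1 : |⟪p 10, b₁⟫| ≤ 1 + 1 / 4000 := abs_inner_unit_le hub₁ (hnm 10)
  have a2 : |⟪p 10, b₂⟫| ≤ 1 + 1 / 4000 := abs_inner_unit_le hub₂ (hnm 10)
  have cX : |⟪p 10, p 0 + p 1⟫ - 0| ≤ 7 / 1000 := by
    rw [inner_add_right, abs_le]; constructor <;> linarith [ga.1, ga.2, gb.1, gb.2]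
  have cY : |⟪p 10, p 0 - p 1⟫ - -1| ≤ 7 / 1000 := by
    rw [inner_sub_right, abs_le]; constructor <;> linarith [ga.1, ga.2, gb.1, gb.2]
  have cZ : |⟪p 10, p 4 - p 5⟫ - 1| ≤ 7 / 1000 := by
    rw [inner_sub_right, abs_le]; constructor <;> linarith [gc.1, gc.2, gd.1, gd.2]
  exact ⟨(std_X hX hn₁ hn₁0 cX).trans (by norm_num), (std_Y hY hn₂ hn₂0 hs₂₁ cY a1).trans (by norm_num),
    (std_Z hZ hn₃ hn₃0 hs₃₁ hs₃₂ cZ a1 a2).trans (by norm_num)⟩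

/-- Coordinates of the good point `p 11` (`fccTab 11 = (0,-1,-1)`; types to `p 0, p 1, p 4, p 5`:
`√3`, contact, `√3`, contact). [folklore] -/
theorem fcc_pt11 {p : Fin 12 → EuclideanSpace ℝ (Fin 3)} {b₁ b₂ b₃ : EuclideanSpace ℝ (Fin 3)} {n₁ n₂ n₃ s₂₁ s₃₁ s₃₂ : ℝ}
    (hX : ∀ x : EuclideanSpace ℝ (Fin 3), ⟪x, b₁⟫ = ⟪x, p 0 + p 1⟫ / n₁)
    (hY : ∀ x : EuclideanSpace ℝ (Fin 3), ⟪x, b₂⟫ = (⟪x, p 0 - p 1⟫ - s₂₁ * ⟪x, b₁⟫) / n₂)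
    (hZ : ∀ x : EuclideanSpace ℝ (Fin 3), ⟪x, b₃⟫ = (⟪x, p 4 - p 5⟫ - s₃₁ * ⟪x, b₁⟫ - s₃₂ * ⟪x, b₂⟫) / n₃)
    (hn₁ : |n₁ ^ 2 - 2| ≤ 141 / 10000) (hn₁0 : 0 < n₁) (hn₂ : |n₂ ^ 2 - 2| ≤ 141 / 10000)
    (hn₂0 : 0 < n₂) (hn₃ : |n₃ ^ 2 - 2| ≤ 141 / 10000) (hn₃0 : 0 < n₃) (hs₂₁ : |s₂₁| ≤ 3 / 2000)
    (hs₃₁ : |s₃₁| ≤ 3 / 1000) (hs₃₂ : |s₃₂| ≤ 3 / 1000) (hub₁ : ‖b₁‖ = 1) (hub₂ : ‖b₂‖ = 1)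
    (hnm : ∀ i, ‖p i‖ ≤ 1 + 1 / 4000) (hG1 : ∀ i j, fccAdj i j → |⟪p i, p j⟫ - 1 / 2| ≤ 1 / 1000)
    (hG3 : ∀ i j, sqNormInt (fccTab i - fccTab j) = 6 → |⟪p i, p j⟫ + 1 / 2| ≤ 3 / 500) :
    |Real.sqrt 2 * ⟪p 11, b₁⟫ - fccTab 11 0| ≤ 71 / 10000 ∧ |Real.sqrt 2 * ⟪p 11, b₂⟫ - fccTab 11 1| ≤ 157 / 10000 ∧
      |Real.sqrt 2 * ⟪p 11, b₃⟫ - fccTab 11 2| ≤ 101 / 5000 := by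
  have e0 : ((fccTab 11 0 : ℤ) : ℝ) = 0 := by simp [fccTab]
  have e1 : ((fccTab 11 1 : ℤ) : ℝ) = -1 := by simp [fccTab]
  have e2 : ((fccTab 11 2 : ℤ) : ℝ) = -1 := by simp [fccTab]
  rw [e0, e1, e2]
  have ga := abs_le.1 (hG3 11 0 (by decide)); have gb := abs_le.1 (hG1 11 1 (by decide))
  have gc := abs_le.1 (hG3 11 4 (by decide)); have gd := abs_le.1 (hG1 11 5 (by decide))
  have a1 : |⟪p 11, b₁⟫| ≤ 1 + 1 / 4000 := abs_inner_unit_le hub₁ (hnm 11)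
  have a2 : |⟪p 11, b₂⟫| ≤ 1 + 1 / 4000 := abs_inner_unit_le hub₂ (hnm 11)
  have cX : |⟪p 11, p 0 + p 1⟫ - 0| ≤ 7 / 1000 := by
    rw [inner_add_right, abs_le]; constructor <;> linarith [ga.1, ga.2, gb.1, gb.2]
  have cY : |⟪p 11, p 0 - p 1⟫ - -1| ≤ 7 / 1000 := by
    rw [inner_sub_right, abs_le]; constructor <;> linarith [ga.1, ga.2, gb.1, gb.2]
  have cZ : |⟪p 11, p 4 - p 5⟫ - -1| ≤ 7 / 1000 := by
    rw [inner_sub_right, abs_le]; constructor <;> linarith [gc.1, gc.2, gd.1, gd.2]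
  exact ⟨(std_X hX hn₁ hn₁0 cX).trans (by norm_num), (std_Y hY hn₂ hn₂0 hs₂₁ cY a1).trans (by norm_num),
    (std_Z hZ hn₃ hn₃0 hs₃₁ hs₃₂ cZ a1 a2).trans (by norm_num)⟩


/-! ### Generic lemmas for the bad points: scaled Parseval and solving for one coordinate -/

/-- Scaled Parseval identity in the frame: `2⟪x, y⟫ = Σₖ (√2⟪x, b_k⟫)(√2⟪y, b_k⟫)`. [folklore] -/
theorem parseval_scaled {b₁ b₂ b₃ : EuclideanSpace ℝ (Fin 3)}
    (hP : ∀ x y : EuclideanSpace ℝ (Fin 3), ⟪x, y⟫ = ⟪x, b₁⟫ * ⟪y, b₁⟫ + ⟪x, b₂⟫ * ⟪y, b₂⟫ + ⟪x, b₃⟫ * ⟪y, b₃⟫)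
    (x y : EuclideanSpace ℝ (Fin 3)) :
    2 * ⟪x, y⟫ = (Real.sqrt 2 * ⟪x, b₁⟫) * (Real.sqrt 2 * ⟪y, b₁⟫) +
      (Real.sqrt 2 * ⟪x, b₂⟫) * (Real.sqrt 2 * ⟪y, b₂⟫) +
      (Real.sqrt 2 * ⟪x, b₃⟫) * (Real.sqrt 2 * ⟪y, b₃⟫) := by
  have h2 : Real.sqrt 2 * Real.sqrt 2 = 2 := Real.mul_self_sqrt (by norm_num)
  rw [hP x y]
  linear_combination (-(⟪x, b₁⟫ * ⟪y, b₁⟫ + ⟪x, b₂⟫ * ⟪y, b₂⟫ + ⟪x, b₃⟫ * ⟪y, b₃⟫)) * h2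

/-- Solving `2 ip = a A + b B + c C` for `a` when `A = 2 ± E_A`, `|b| ≤ M_b`, `|B| ≤ E_B`, `|c| ≤ M_c`,
`|C| ≤ E_C`, `2 ip = N ± e₀`: `|a - N/2| ≤ (e₀ + M_b E_B + M_c E_C + |N| E_A/2)/(2 - E_A)`. [folklore] -/
theorem solve_coord {ip a A b B c C N e0 Mb EB Mc EC EA : ℝ}
    (hP : 2 * ip = a * A + b * B + c * C)
    (h0 : |2 * ip - N| ≤ e0) (hb : |b| ≤ Mb) (hB : |B| ≤ EB) (hc : |c| ≤ Mc) (hC : |C| ≤ EC)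
    (hA : |A - 2| ≤ EA) (hEA : EA < 2) :
    |a - N / 2| ≤ (e0 + Mb * EB + Mc * EC + |N| * EA / 2) / (2 - EA) := by
  have hA' := abs_le.1 hA
  have hApos : 0 < A := by linarith
  have ha : a = (2 * ip - b * B - c * C) / A := by
    rw [eq_div_iff hApos.ne']; linarith
  rw [ha]
  refine abs_div_sub_div_le ?_ hA (by linarith) two_pos
  have h1 := mul_bounds_of_abs_le hb hB
  have h2 := mul_bounds_of_abs_le hc hC
  have h0' := abs_le.1 h0
  rw [abs_le]; constructor <;> linarith [h1.1, h1.2, h2.1, h2.2, h0'.1, h0'.2]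

/-- A priori bound on a scaled coordinate of a shell point: `|√2 ⟪x, b⟫| ≤ 283/200`. [folklore] -/
theorem abs_scaled_le {x b : EuclideanSpace ℝ (Fin 3)} (hb : ‖b‖ = 1) (hx : ‖x‖ ≤ 1 + 1 / 4000) :
    |Real.sqrt 2 * ⟪x, b⟫| ≤ 283 / 200 := by
  have h1 : |⟪x, b⟫| ≤ 1 + 1 / 4000 := abs_inner_unit_le hb hx
  have hs : Real.sqrt 2 ≤ 14143 / 10000 := by rw [Real.sqrt_le_iff]; norm_num
  rw [abs_mul, abs_of_nonneg (Real.sqrt_nonneg _)]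
  calc Real.sqrt 2 * |⟪x, b⟫| ≤ 14143 / 10000 * (1 + 1 / 4000) :=
        mul_le_mul hs h1 (abs_nonneg _) (by norm_num)
    _ ≤ 283 / 200 := by norm_num

/-- From a scaled bound to an unscaled one: `|√2 a| ≤ B` gives `|a| ≤ B`. [folklore] -/
theorem abs_le_of_scaled {a B : ℝ} (h : |Real.sqrt 2 * a - 0| ≤ B) : |a| ≤ B := by
  rw [sub_zero, abs_mul, abs_of_nonneg (Real.sqrt_nonneg _)] at h
  have hs : (1 : ℝ) ≤ Real.sqrt 2 := by
    rw [Real.le_sqrt (by norm_num) (by norm_num)]; norm_num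
  calc |a| = 1 * |a| := (one_mul _).symm
    _ ≤ Real.sqrt 2 * |a| := mul_le_mul_of_nonneg_right hs (abs_nonneg _)
    _ ≤ B := h

/-! ### Registered sub-goal (one line, fully qualified) -/

/-- **Registered sub-goal `fcc_good_pt0`** (helper of `stub_coordsFcc`, lead c4): the coordinate bound of
the good point `p 0`, verbatim the registered one-line signature (`= fcc_pt0`). [folklore] -/
theorem fcc_good_pt0 : ∀ {p : Fin 12 → EuclideanSpace ℝ (Fin 3)} {b₁ b₂ b₃ : EuclideanSpace ℝ (Fin 3)} {n₁ n₂ n₃ s₂₁ s₃₁ s₃₂ : ℝ}, (∀ x : EuclideanSpace ℝ (Fin 3), inner ℝ (x) (b₁) = inner ℝ (x) (p 0 + p 1) / n₁) → (∀ x : EuclideanSpace ℝ (Fin 3), inner ℝ (x) (b₂) = (inner ℝ (x) (p 0 - p 1) - s₂₁ * inner ℝ (x) (b₁)) / n₂) → (∀ x : EuclideanSpace ℝ (Fin 3), inner ℝ (x) (b₃) = (inner ℝ (x) (p 4 - p 5) - s₃₁ * inner ℝ (x) (b₁) - s₃₂ * inner ℝ (x) (b₂)) / n₃) → (|n₁ ^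 2 - 2| ≤ 141 / 10000) → (0 < n₁) → (|n₂ ^ 2 - 2| ≤ 141 / 10000) → (0 < n₂) → (|n₃ ^ 2 - 2| ≤ 141 / 10000) → (0 < n₃) → (|s₂₁| ≤ 3 / 2000) → (|s₃₁| ≤ 3 / 1000) → (|s₃₂| ≤ 3 / 1000) → (‖b₁‖ = 1) → (‖b₂‖ = 1) → (∀ i, ‖p i‖ ≤ 1 + 1 / 4000) → (∀ i, |inner ℝ (p i) (p i) - 1| ≤ 1 / 1000) → (∀ i j, Literature.Geometry.DiscreteGeometry.fccAdj i j → |inner ℝ (p i) (p j) - 1 / 2| ≤ 1 / 1000) → (∀ i j, Literature.Geometry.DiscreteGeometry.sqNormInt (Literature.Geometry.DiscreteGeometry.fccTab i - Literature.Geometry.DiscreteGeometry.fccTab j) = 4 → |inner ℝ (p i) (p j)| ≤ 3 / 500) → |Real.sqrt 2 * inner ℝ (p 0) (b₁) - Literature.Geometry.DiscreteGeometry.fccTab 0 0| ≤ 71 / 5000 ∧ |Real.sqrt 2 * inner ℝ (p 0) (b₂) - Literature.Geometry.DiscreteGeometry.fccTab 0 1| ≤ 157 / 10000 ∧ |Real.sqrt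 2 * inner ℝ (p 0) (b₃) - Literature.Geometry.DiscreteGeometry.fccTab 0 2| ≤ 81 / 10000 :=
  fcc_pt0

end Summit.AtomisticToContinuum.Crystallization.Theorems.ZeroDefectDensityBirth

end
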